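import Literature.IUT.HodgeTheaters.InitialThetaDataTorsionMonodromyModel
import HarnessLib

/-!
# [IUTchI] Def 3.1 (b)(d) / [EtTh] Def 2.1 «type `(1, l-tors)±`»: the profinite group `Π_{C_F} := E_F[l](F̄) ⋊ (G_F × {±1})`,
# `Π_{X_F}`, and the `K`-level data `Π_{C_K} := G_K × (E_F[l](F̄) ⋊ {±1})` (NV-L5 witness «TorsionMonodromy-NV», part 2)

S. Mochizuki, *Inter-universal Teichmüller theory I*, kurims manuscript (May 2020), §3 Definition 3.1 (d) p. 62
«`C̲_K` is a hyperbolic orbicurve of type `(1, l-tors)±` … over `K`, with `K`-core `C_K := C_F ×_F K` … determines,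
up to `K`-isomorphism, a hyperbolic orbicurve `X̲_K` of type `(1, l-tors)`»; [EtTh] Def 2.1 p. 36 «a quotient onto a
free `(ℤ/lℤ)`-module `Q` of rank `1` such that the restricted map `Δ̄^ell_X → Q` is still surjective … the
corresponding covering `X̲^log → X^log`»; §1 p. 37 «(∗) the natural action of `G_k` on `Δ_X^{ab} ⊗ (ℤ/lℤ)` is
trivial» ([IUTchI] Def 3.1 (d) p.62) [claim: Mochizuki2012, status: disputed] (D-0012 claim key; series status
DISPUTED — a MODEL of the cell's `π₁`-interface structures; nothing of the series is asserted; no side taken on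
[IUTchIII] Cor. 3.12).

## WHAT (continuing `InitialThetaDataTorsionMonodromyModel.lean`: the normal factor `E_F[l](F̄)` with its `G_F × {±1}`-action)

* `PiC F E Fbar l := E_F[l](F̄) ⋊[act] (G_F × ℤˣ)` — topologised along `(left, right)`, a PROFINITE group by the tree's
  generic `SettingModel.Semidirect.*` API (abc-iut-L2); `ext` — the augmentation `⟨t, (σ, u)⟩ ↦ σ` as a
  `FundamentalExtension` (abc-iut-L4-t1), `Δ_C = E_F[l] ⋊ (1 × ℤˣ)`; `PiX := Ker(sgn : Π_{C_F} → ℤˣ) = E_F[l] ⋊ (G_F × 1)`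
  (open, normal, index `2`, `↠ G_F`; Def 3.1 (b) «`C_F` … by the unique `F`-involution `−1`»), `Δ_X = E_F[l](F̄)`;
* `Dih E Fbar l := E_F[l](F̄) ⋊ {±1}` — the GENERALISED DIHEDRAL group of the `l`-torsion (finite, discrete): the
  finite factor of `Π_{C_K} := G_K × (E_F[l](F̄) ⋊ {±1})`, a PRODUCT because `G_K = Ker(G_F → GL₂(𝔽_l))` acts
  TRIVIALLY on `E_F[l](F̄)` (Def 3.1 (c) `range_K_iff` = §1 (∗) for `k := K`); its subgroups `dX = E_F[l] ⋊ 1`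
  (index `2`), `dC g = ℤ·g ⋊ {±1}` (index `l`), `dXbar g = ℤ·g ⋊ 1`, so that `Π_{X_K} = G_K × dX`,
  `Π_{C̲_K} = G_K × dC g`, `Π_{X̲_K} = G_K × dXbar g`: the covering `X̲_K → X_K` «determined by the rank one quotient
  `Q = E_F[l]/𝔽_l·g`» has degree `[E_F[l](F̄) : ℤ·g] = l` (from `#E_F[l](F̄) = l²`, hypothesis `hcard`),
  `[Π_{C̲_K} : Π_{X̲_K}] = 2`, `Π_{C̲_K} ⊄ Π_{X_K}`;
* `pedOf G g` — abc-iut-L5-t1's `PuncturedEllipticData` ([IUTchI] §1) on `G × Dih` for any profinite `G` (used with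
  `G := G_K`): four cusp labels with decomposition group `G × 1`; (∗) holds because `E_F[l]` is commutative.
Part 3 (`…ModelGeometry.lean`): the embedding `Π_{C_K} ↪ Π_{C_F}`, the assembled `ThetaGeometry`, the re-geometrised
initial Θ-datum and its `TorsionMonodromy` term.

HONEST LABEL.  A MODEL (non-vacuity evidence): finite `Δ_X`, cusp LABELS and decomposition groups `G × 1` are
synthetic; only the `l`-torsion with its sign is the curve's.  Instances only on this file's model types.
Instantiated ≠ endorsed; typed ≠ proved; no side taken on [IUTchIII] Cor. 3.12.
-/

noncomputable section

namespace Literature.IUT.HodgeTheaters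

universe u

namespace TorsionMonodromyModel

open Literature.AnabelianGeometry.AbsoluteAnabelian Topology
open Literature.AnabelianGeometry.EtaleTheta.SettingModel
open scoped WeierstrassCurve.Affine Classical

variable {F : Type u} [Field F] (E : WeierstrassCurve F) (Fbar : Type u) [Field Fbar] [Algebra F Fbar] (l : ℕ)

/-! ## `Π_{C_F} := E_F[l](F̄) ⋊ (G_F × {±1})` as a profinite group; `Π_{C_F} ↠ G_F`; `Π_{X_F}` -/

variable (F) in
/-- **The model `Π_{C_F} := E_F[l](F̄) ⋊ (G_F × {±1})`** (a quotient of the genuine `Π_{C_F}`: the `l`-torsion monodromy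
of `E_F` with `Gal(X_F/C_F) = {±1}`); a model type of this file. [cite: Mochizuki2012, IUTchI Def 3.1 (b) p.61] -/
abbrev PiC : Type u := Tors E Fbar l ⋊[act F E Fbar l] GalPM F Fbar

namespace PiC

/-- The topology of `Π_{C_F}`: induced along `g ↦ (g.left, g.right)` from `E_F[l](F̄) × (G_F × {±1})`. [folklore] -/
instance instTopologicalSpace : TopologicalSpace (PiC F E Fbar l) :=
  TopologicalSpace.induced (fun g : PiC F E Fbar l => (g.left, g.right)) inferInstance

/-- `g ↦ (g.left, g.right)` is inducing (by definition of the topology). [cite: Mochizuki2012, IUTchI Def 3.1 (b) p.61] -/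
theorem isInducing : IsInducing fun g : PiC F E Fbar l => (g.left, g.right) := ⟨rfl⟩

/-- `Π_{C_F}` is a topological group (jointly continuous action). [folklore] -/
instance instIsTopologicalGroup [IsGalois F Fbar] [E.IsElliptic] [NeZero l] : IsTopologicalGroup (PiC F E Fbar l) :=
  Semidirect.isTopologicalGroup_of_continuous_action (isInducing E Fbar l) (continuous_act E Fbar l)

/-- `Π_{C_F}` is compact (`E_F[l](F̄)` finite, `G_F` profinite). [folklore] -/
instance instCompactSpace [IsGalois F Fbar] [E.IsElliptic] [NeZero l] : CompactSpace (PiC F E Fbar l) :=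
  Semidirect.compactSpace_of (isInducing E Fbar l)

/-- `Π_{C_F}` is totally disconnected. [folklore] -/
instance instTotallyDisconnectedSpace [IsGalois F Fbar] : TotallyDisconnectedSpace (PiC F E Fbar l) :=
  Semidirect.totallyDisconnectedSpace_of (isInducing E Fbar l)

end PiC

section Ext

variable [IsGalois F Fbar] [E.IsElliptic] [NeZero l]

variable (F) in
/-- **`Π_{C_F} ↠ G_F`** of the model as a `FundamentalExtension` (abc-iut-L4-t1): `⟨t, (σ, u)⟩ ↦ σ`, so
`Δ_C = E_F[l](F̄) ⋊ (1 × {±1})`. [cite: Mochizuki2012, IUTchI Def 3.1 (b) p.61] -/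
def ext : FundamentalExtension.{u} where
  arith := ProfiniteGrp.of (PiC F E Fbar l)
  gal := ProfiniteGrp.of (Fbar ≃ₐ[F] Fbar)
  aug := (ContinuousMonoidHom.fst (Fbar ≃ₐ[F] Fbar) ℤˣ).comp (Semidirect.rightHomCont (PiC.isInducing E Fbar l))
  aug_surjective σ := ⟨SemidirectProduct.inr (σ, 1), rfl⟩

/-- The augmentation of the model: `aug ⟨t, (σ, u)⟩ = σ`. [cite: Mochizuki2012, IUTchI Def 3.1 (b) p.61] -/
@[simp] theorem ext_aug_apply (g : PiC F E Fbar l) : (ext F E Fbar l).aug g = g.right.1 := rfl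

/-- `Δ_C` of the model: `g ∈ Δ_C ↔ g.right.1 = 1`. [cite: Mochizuki2012, IUTchI Def 3.1 (b) p.61] -/
theorem mem_geom_ext_iff (g : PiC F E Fbar l) :
    (g : (ext F E Fbar l).arith) ∈ (ext F E Fbar l).geom ↔ g.right.1 = 1 :=
  (ext F E Fbar l).mem_geom

end Ext

variable (F) in
/-- `sgn : Π_{C_F} → Gal(X_F/C_F) = {±1}`, `⟨t, (σ, u)⟩ ↦ u`. [cite: Mochizuki2012, IUTchI Def 3.1 (b) p.61] -/
def sgn : PiC F E Fbar l →* ℤˣ := (MonoidHom.snd (Fbar ≃ₐ[F] Fbar) ℤˣ).comp SemidirectProduct.rightHom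

/-- [cite: Mochizuki2012, IUTchI Def 3.1 (b) p.61] -/
@[simp] theorem sgn_apply (g : PiC F E Fbar l) : sgn F E Fbar l g = g.right.2 := rfl

/-- `sgn` is surjective. [cite: Mochizuki2012, IUTchI Def 3.1 (b) p.61] -/
theorem sgn_surjective : Function.Surjective (sgn F E Fbar l) := fun u => ⟨SemidirectProduct.inr (1, u), rfl⟩

variable (F) in
/-- **`Π_{X_F} := Ker(sgn) = E_F[l](F̄) ⋊ (G_F × 1)`** (`X_F → C_F` the quotient by `±1`). [cite: Mochizuki2012, IUTchI Def 3.1 (b) p.61] -/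
def PiX : Subgroup (PiC F E Fbar l) := (sgn F E Fbar l).ker

/-- [cite: Mochizuki2012, IUTchI Def 3.1 (b) p.61] -/
theorem mem_PiX_iff (g : PiC F E Fbar l) : g ∈ PiX F E Fbar l ↔ g.right.2 = 1 := Iff.rfl

/-- `Π_{X_F}` is normal. [cite: Mochizuki2012, IUTchI Def 3.1 (b) p.61] -/
instance PiX_normal : (PiX F E Fbar l).Normal := inferInstanceAs (sgn F E Fbar l).ker.Normal

/-- `[Π_{C_F} : Π_{X_F}] = 2`. [cite: Mochizuki2012, IUTchI Def 3.1 (b) p.61] -/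
theorem PiX_index : (PiX F E Fbar l).index = 2 := by
  rw [PiX, Subgroup.index_ker, MonoidHom.range_eq_top.mpr (sgn_surjective E Fbar l), Subgroup.card_top,
    Nat.card_eq_fintype_card, Fintype.card_units_int]

/-- `Π_{X_F}` is open. [cite: Mochizuki2012, IUTchI Def 3.1 (b) p.61] -/
theorem PiX_isOpen : IsOpen (PiX F E Fbar l : Set (PiC F E Fbar l)) := by
  have h : (PiX F E Fbar l : Set (PiC F E Fbar l)) = (fun g : PiC F E Fbar l => g.right.2) ⁻¹' {1} := rfl
  rw [h]
  exact (isOpen_discrete _).preimage (continuous_snd.comp (Semidirect.continuous_right (PiC.isInducing E Fbar l)))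

/-- `inr (σ, 1) ∈ Π_{X_F}`. [cite: Mochizuki2012, IUTchI Def 3.1 (b) p.61] -/
theorem inr_mem_PiX (σ : Fbar ≃ₐ[F] Fbar) : (SemidirectProduct.inr (σ, 1) : PiC F E Fbar l) ∈ PiX F E Fbar l := rfl

/-- `inl t ∈ Π_{X_F}` (`E_F[l](F̄) ⊆ Δ_X`). [cite: Mochizuki2012, IUTchI Def 3.1 (b) p.61] -/
theorem inl_mem_PiX (t : Tors E Fbar l) : (SemidirectProduct.inl t : PiC F E Fbar l) ∈ PiX F E Fbar l := rfl


/-! ## The generalised dihedral group `E_F[l](F̄) ⋊ {±1}` and its three subgroups -/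

/-- `sgnRep u t = t ^ u` (`u = ±1`). [cite: Mochizuki2012, IUTchI Def 3.1 (b) p.61] -/
theorem sgnRep_apply_eq_zpow (u : ℤˣ) (t : Tors E Fbar l) : sgnRep E Fbar l u t = t ^ (u : ℤ) :=
  Tors.pt_injective (by rw [pt_sgnRep, Tors.pt_zpow])

/-- **`Dih := E_F[l](F̄) ⋊ {±1}`**, the finite factor of the model's `Π_{C_K}` (the `l`-torsion with the involution;
discrete); a model type of this file. [cite: Mochizuki2012, IUTchI Def 3.1 (d) p.62] -/
abbrev Dih : Type u := Tors E Fbar l ⋊[sgnRep E Fbar l] ℤˣ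

namespace Dih

/-- The discrete topology on the finite factor. [folklore] -/
instance instTopologicalSpace : TopologicalSpace (Dih E Fbar l) := ⊥

/-- The topology is discrete by definition. [folklore] -/
instance instDiscreteTopology : DiscreteTopology (Dih E Fbar l) := ⟨rfl⟩

/-- A discrete group is a topological group. [folklore] -/
instance instIsTopologicalGroup : IsTopologicalGroup (Dih E Fbar l) where
  continuous_mul := continuous_of_discreteTopology
  continuous_inv := continuous_of_discreteTopology

/-- `E_F[l](F̄) ⋊ {±1}` is finite. [folklore] -/
instance instFinite [E.IsElliptic] [NeZero l] : Finite (Dih E Fbar l) :=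
  Finite.of_equiv _ SemidirectProduct.equivProd.symm

/-- `#(E_F[l](F̄) ⋊ {±1}) = 2·#E_F[l](F̄)`. [cite: Mochizuki2012, IUTchI Def 3.1 (d) p.62] -/
theorem card [E.IsElliptic] [NeZero l] : Nat.card (Dih E Fbar l) = Nat.card (Tors E Fbar l) * 2 := by
  rw [Nat.card_congr SemidirectProduct.equivProd, Nat.card_prod, Nat.card_eq_fintype_card (α := ℤˣ),
    Fintype.card_units_int]

variable {E Fbar l} in
/-- Commutators of elements of `E_F[l] ⋊ 1` are trivial (the torsion is commutative): condition (∗) of §1 at `k := K`.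
[cite: Mochizuki2012, IUTchI §1 p.37] -/
theorem comm_eq_one {x y : Dih E Fbar l} (hx : x.right = 1) (hy : y.right = 1) : x * y * x⁻¹ * y⁻¹ = 1 := by
  have hx' : x = SemidirectProduct.inl x.left := by
    rw [← SemidirectProduct.inl_left_mul_inr_right x, hx, map_one, mul_one, SemidirectProduct.left_inl]
  have hy' : y = SemidirectProduct.inl y.left := by
    rw [← SemidirectProduct.inl_left_mul_inr_right y, hy, map_one, mul_one, SemidirectProduct.left_inl]
  rw [hx', hy', ← map_inv, ← map_inv, ← map_mul, ← map_mul, ← map_mul, mul_inv_eq_one.mpr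
    (mul_inv_eq_iff_eq_mul.mpr (mul_comm _ _)), map_one]

variable (F) {Fbar l}

/-- `dX := E_F[l](F̄) ⋊ 1 = Ker(Dih → {±1})` (so `Π_{X_K} = G_K × dX`). [cite: Mochizuki2012, IUTchI Def 3.1 (d) p.62] -/
def dX : Subgroup (Dih E Fbar l) := (SemidirectProduct.rightHom : Dih E Fbar l →* ℤˣ).ker

/-- `dC g := ℤ·g ⋊ {±1}` (so `Π_{C̲_K} = G_K × dC g`): the line with the involution. [cite: Mochizuki2012, IUTchI Def 3.1 (d) p.62] -/
def dC (g : Tors E Fbar l) : Subgroup (Dih E Fbar l) where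
  carrier := {x | x.left ∈ Subgroup.zpowers g}
  mul_mem' {x y} hx hy := by
    show (x * y).left ∈ Subgroup.zpowers g
    rw [SemidirectProduct.mul_left, sgnRep_apply_eq_zpow]
    exact mul_mem hx (Subgroup.zpow_mem _ hy _)
  one_mem' := by
    show (1 : Dih E Fbar l).left ∈ Subgroup.zpowers g
    rw [SemidirectProduct.one_left]
    exact one_mem _
  inv_mem' {x} hx := by
    show x⁻¹.left ∈ Subgroup.zpowers g
    rw [SemidirectProduct.inv_left, sgnRep_apply_eq_zpow]
    exact Subgroup.zpow_mem _ (inv_mem hx) _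

/-- `dXbar g := dX ∩ dC g = ℤ·g ⋊ 1` (so `Π_{X̲_K} = G_K × dXbar g`). [cite: Mochizuki2012, IUTchI Def 3.1 (d) p.62] -/
def dXbar (g : Tors E Fbar l) : Subgroup (Dih E Fbar l) := dX F E ⊓ dC F E g

variable {F E}

/-- [cite: Mochizuki2012, IUTchI Def 3.1 (d) p.62] -/
theorem mem_dX_iff (x : Dih E Fbar l) : x ∈ dX F E ↔ x.right = 1 := Iff.rfl

/-- [cite: Mochizuki2012, IUTchI Def 3.1 (d) p.62] -/
theorem mem_dC_iff (g : Tors E Fbar l) (x : Dih E Fbar l) : x ∈ dC F E g ↔ x.left ∈ Subgroup.zpowers g := Iff.rfl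

/-- [cite: Mochizuki2012, IUTchI Def 3.1 (d) p.62] -/
theorem mem_dXbar_iff (g : Tors E Fbar l) (x : Dih E Fbar l) :
    x ∈ dXbar F E g ↔ x.right = 1 ∧ x.left ∈ Subgroup.zpowers g := Iff.rfl

/-- `[Dih : dX] = 2`. [cite: Mochizuki2012, IUTchI Def 3.1 (d) p.62] -/
theorem dX_index : (dX F E : Subgroup (Dih E Fbar l)).index = 2 := by
  rw [dX, Subgroup.index_ker, MonoidHom.range_eq_top.mpr SemidirectProduct.rightHom_surjective, Subgroup.card_top,
    Nat.card_eq_fintype_card, Fintype.card_units_int]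

/-- `#(ℤ·g ⋊ {±1}) = 2l` (`g ≠ 1`, `l` prime). [cite: Mochizuki2012, IUTchI Def 3.1 (d) p.62] -/
theorem card_dC (hl : l.Prime) {g : Tors E Fbar l} (hg : g ≠ 1) : Nat.card ↥(dC F E g) = l * 2 := by
  let e : ↥(dC F E g) ≃ ↥(Subgroup.zpowers g) × ℤˣ :=
    { toFun := fun x => (⟨x.1.left, x.2⟩, x.1.right)
      invFun := fun p => ⟨⟨(p.1 : Tors E Fbar l), p.2⟩, p.1.2⟩
      left_inv := fun x => Subtype.ext (SemidirectProduct.ext rfl rfl)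
      right_inv := fun p => Prod.ext (Subtype.ext rfl) rfl }
  rw [Nat.card_congr e, Nat.card_prod, Tors.card_zpowers hl hg, Nat.card_eq_fintype_card (α := ℤˣ),
    Fintype.card_units_int]

/-- `#(ℤ·g ⋊ 1) = l`. [cite: Mochizuki2012, IUTchI Def 3.1 (d) p.62] -/
theorem card_dXbar (hl : l.Prime) {g : Tors E Fbar l} (hg : g ≠ 1) : Nat.card ↥(dXbar F E g) = l := by
  let e : ↥(dXbar F E g) ≃ ↥(Subgroup.zpowers g) :=
    { toFun := fun x => ⟨x.1.left, x.2.2⟩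
      invFun := fun a => ⟨SemidirectProduct.inl (a : Tors E Fbar l), rfl, a.2⟩
      left_inv := fun x => Subtype.ext (SemidirectProduct.ext rfl x.2.1.symm)
      right_inv := fun a => Subtype.ext rfl }
  rw [Nat.card_congr e, Tors.card_zpowers hl hg]

variable [E.IsElliptic] [NeZero l]

/-- `[Dih : dC g] = l`. [cite: Mochizuki2012, IUTchI Def 3.1 (d) p.62] -/
theorem dC_index (hl : l.Prime) (hcard : Nat.card (Tors E Fbar l) = l ^ 2) {g : Tors E Fbar l} (hg : g ≠ 1) :
    (dC F E g).index = l := by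
  have h := Subgroup.card_mul_index (dC F E g)
  rw [card_dC hl hg, card, hcard] at h
  have h' : l * 2 * (dC F E g).index = l * 2 * l := by rw [h]; ring
  exact Nat.eq_of_mul_eq_mul_left (Nat.mul_pos hl.pos two_pos) h'

/-- `[Dih : dXbar g] = 2l`. [cite: Mochizuki2012, IUTchI Def 3.1 (d) p.62] -/
theorem dXbar_index (hl : l.Prime) (hcard : Nat.card (Tors E Fbar l) = l ^ 2) {g : Tors E Fbar l} (hg : g ≠ 1) :
    (dXbar F E g).index = l * 2 := by
  have h := Subgroup.card_mul_index (dXbar F E g)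
  rw [card_dXbar hl hg, card, hcard] at h
  have h' : l * (dXbar F E g).index = l * (l * 2) := by rw [h]; ring
  exact Nat.eq_of_mul_eq_mul_left hl.pos h'

/-- `[dX : dXbar g] = l`: the degree of `X̲_K → X_K`. [cite: Mochizuki2012, IUTchI Def 3.1 (d) p.62] -/
theorem dXbar_relIndex_dX (hl : l.Prime) (hcard : Nat.card (Tors E Fbar l) = l ^ 2) {g : Tors E Fbar l} (hg : g ≠ 1) :
    (dXbar F E g).relIndex (dX F E) = l := by
  have hle : dXbar F E g ≤ dX F E := inf_le_left
  have h := Subgroup.relIndex_mul_index hle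
  rw [dX_index, dXbar_index hl hcard hg] at h
  exact Nat.eq_of_mul_eq_mul_right two_pos h

/-- `[dC g : dXbar g] = 2`: the degree of `X̲_K → C̲_K`. [cite: Mochizuki2012, IUTchI Def 3.1 (d) p.62] -/
theorem dXbar_relIndex_dC (hl : l.Prime) (hcard : Nat.card (Tors E Fbar l) = l ^ 2) {g : Tors E Fbar l} (hg : g ≠ 1) :
    (dXbar F E g).relIndex (dC F E g) = 2 := by
  have hle : dXbar F E g ≤ dC F E g := inf_le_right
  have h := Subgroup.relIndex_mul_index hle
  rw [dC_index hl hcard hg, dXbar_index hl hcard hg, mul_comm l 2] at h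
  exact Nat.eq_of_mul_eq_mul_right hl.pos h

omit [E.IsElliptic] [NeZero l] in
/-- `dC g ⊄ dX` (the involution `⟨1, −1⟩`): `C̲_K` is not a covering of `X_K`. [cite: Mochizuki2012, IUTchI Def 3.1 (d) p.62] -/
theorem not_dC_le_dX (g : Tors E Fbar l) : ¬ dC F E g ≤ dX F E := by
  intro h
  have hmem : (SemidirectProduct.inr (-1) : Dih E Fbar l) ∈ dC F E g := by
    rw [mem_dC_iff, SemidirectProduct.left_inr]
    exact one_mem _
  have h1 : (-1 : ℤˣ) = 1 := (mem_dX_iff _).mp (h hmem)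
  exact absurd (congrArg Units.val h1) (by decide)

end Dih

/-! ## The `K`-level data `Π_{C_K} := G × (E_F[l](F̄) ⋊ {±1})` over a profinite `G` (for `G := G_K`) -/

section KLevel

variable {E Fbar l}

/-- `G × D ⊆ G × Dih` for a subgroup `D` of the finite factor. [cite: Mochizuki2012, IUTchI §1 p.37] -/
def lift (G : Type u) [Group G] (D : Subgroup (Dih E Fbar l)) : Subgroup (G × Dih E Fbar l) :=
  D.comap (MonoidHom.snd G (Dih E Fbar l))

/-- [cite: Mochizuki2012, IUTchI §1 p.37] -/
@[simp] theorem mem_lift {G : Type u} [Group G] {D : Subgroup (Dih E Fbar l)} {x : G × Dih E Fbar l} :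
    x ∈ lift G D ↔ x.2 ∈ D := Iff.rfl

/-- `[G × Dih : G × D] = [Dih : D]`. [cite: Mochizuki2012, IUTchI §1 p.37] -/
theorem lift_index (G : Type u) [Group G] (D : Subgroup (Dih E Fbar l)) : (lift G D).index = D.index :=
  Subgroup.index_comap_of_surjective D Prod.snd_surjective

/-- Relative indices of lifted subgroups are computed in the finite factor. [cite: Mochizuki2012, IUTchI §1 p.37] -/
theorem lift_relIndex (G : Type u) [Group G] (D D' : Subgroup (Dih E Fbar l)) :
    (lift G D).relIndex (lift G D') = D.relIndex D' := by
  rw [lift, lift, Subgroup.relIndex_comap, Subgroup.map_comap_eq_self_of_surjective Prod.snd_surjective]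

/-- [cite: Mochizuki2012, IUTchI §1 p.37] -/
theorem lift_inf (G : Type u) [Group G] (D D' : Subgroup (Dih E Fbar l)) : lift G (D ⊓ D') = lift G D ⊓ lift G D' :=
  Subgroup.comap_inf D D' _

/-- [cite: Mochizuki2012, IUTchI §1 p.37] -/
theorem lift_mono (G : Type u) [Group G] {D D' : Subgroup (Dih E Fbar l)} (h : D ≤ D') : lift G D ≤ lift G D' :=
  Subgroup.comap_mono h

/-- `G × D ↠ G`. [cite: Mochizuki2012, IUTchI §1 p.37] -/
theorem fst_lift_surjective (G : Type u) [Group G] (D : Subgroup (Dih E Fbar l)) :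
    Function.Surjective ((MonoidHom.fst G (Dih E Fbar l)).comp (lift G D).subtype) :=
  fun g => ⟨⟨(g, 1), by simp⟩, rfl⟩

/-- `G × D` is open (the finite factor is discrete). [cite: Mochizuki2012, IUTchI §1 p.37] -/
theorem isOpen_lift (G : Type u) [Group G] [TopologicalSpace G] (D : Subgroup (Dih E Fbar l)) :
    IsOpen (lift G D : Set (G × Dih E Fbar l)) :=
  (isOpen_discrete (D : Set (Dih E Fbar l))).preimage continuous_snd

variable (G : Type u) [Group G] [TopologicalSpace G] [IsTopologicalGroup G] [CompactSpace G]
  [TotallyDisconnectedSpace G] [E.IsElliptic] [NeZero l]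

/-- `Π_{C_K} := G × (E_F[l](F̄) ⋊ {±1}) ↠ G` as a `FundamentalExtension`. [cite: Mochizuki2012, IUTchI Def 3.1 (d) p.62] -/
def extK : FundamentalExtension.{u} where
  arith := ProfiniteGrp.of (G × Dih E Fbar l)
  gal := ProfiniteGrp.of G
  aug := ContinuousMonoidHom.fst G (Dih E Fbar l)
  aug_surjective := Prod.fst_surjective

/-- **The `K`-level data of the model** ([IUTchI] §1 `PuncturedEllipticData` over `G = G_K`): `Π_C := G × (E_F[l] ⋊ {±1})`,
`Π_X := G × (E_F[l] ⋊ 1)`, `Π_{C̲} := G × (ℤ·g ⋊ {±1})`, four cusp labels with decomposition group `G × 1`; (∗) holds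
because `E_F[l]` is commutative and `G` does not act. [cite: Mochizuki2012, IUTchI §1 p.37] -/
def pedOf (g : Tors E Fbar l) (h5 : 5 ≤ l) (h6 : l.Coprime 6) : PuncturedEllipticData.{u} where
  l := l
  five_le := h5
  coprime_six := h6
  E := extK G
  PiX := lift G (Dih.dX F E)
  PiCbar := lift G (Dih.dC F E g)
  isOpen_piX := isOpen_lift G _
  isOpen_piCbar := isOpen_lift G _
  index_piX := (lift_index G _).trans Dih.dX_index
  aug_piX := fst_lift_surjective G _
  aug_piCbar := fst_lift_surjective G _
  star := by
    intro g' hg' x hx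
    have hx1 : x.1 = 1 := (FundamentalExtension.mem_geom _).mp hx.2
    have hx2 : x.2.right = 1 := (Dih.mem_dX_iff _).mp (mem_lift.mp hx.1)
    have hg2 : g'.2.right = 1 := (Dih.mem_dX_iff _).mp (mem_lift.mp hg')
    have h0 : g' * x * g'⁻¹ * x⁻¹ = 1 := by
      refine Prod.ext ?_ (Dih.comm_eq_one hg2 hx2)
      show g'.1 * x.1 * g'.1⁻¹ * x.1⁻¹ = 1
      rw [hx1, mul_one, inv_one, mul_one, mul_inv_cancel]
    rw [h0]
    exact Subgroup.one_mem _
  Cusp := ULift.{u} (Fin 4)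
  decomp := fun _ => lift G ⊥
  decomp_le := fun _ => le_inf (lift_mono G bot_le) (lift_mono G bot_le)
  ε0 := ⟨0⟩
  ε1 := ⟨1⟩
  ε2 := ⟨2⟩
  twoε := ⟨3⟩
  ε1_ne_ε0 := by decide
  ε2_ne_ε0 := by decide
  ε1_ne_ε2 := by decide
  twoε_ne := by decide
  aug_decomp_twoε := fst_lift_surjective G ⊥

/-- `Π_{X̲} = Π_X ∩ Π_{C̲}` of the `K`-level model is `G × (ℤ·g ⋊ 1)`. [cite: Mochizuki2012, IUTchI Def 3.1 (d) p.62] -/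
theorem pedOf_PiXbar (g : Tors E Fbar l) (h5 : 5 ≤ l) (h6 : l.Coprime 6) :
    (pedOf G g h5 h6).PiXbar = lift G (Dih.dXbar F E g) := by
  show lift G (Dih.dX F E) ⊓ lift G (Dih.dC F E g) = lift G (Dih.dXbar F E g)
  rw [← lift_inf]
  rfl

end KLevel


end TorsionMonodromyModel

end Literature.IUT.HodgeTheaters

end
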